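import Summits.BirchSwinnertonDyer.BirchSwinnertonDyer.Theorems.KolyvaginRoadThreeMethod2LocalInputsLineTrans
import HarnessLib

/-!
# Route `KolyvaginRoadThree`, deciding crux `ZhangSharpFrameAtThreeHL` (item stmt-BirchSwinnertonDyer-19574):
# the input (Cheb) of stub A `stub_levelRaisingAtThree` REDUCED to its Galois form — a unipotent-admissible prime
# with a Frobenius `F` at which the class has `[x, F] ∉ (F − 1)E[3]`
# (cell `bsd-stepL`, seat `bsd-stepL-zhang3-p1` g7; `--supports stmt-BirchSwinnertonDyer-19574`, helper)

WHY THIS FILE. After `KolyvaginRoadThreeMethod2LocalInputsLineTrans` ∕ `…LocalEquivOfTame` ∕ `…TameSign` (zhang3-p1 g7),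
stub A of crux 19574 is (Cheb) + (Iso) (`stub_levelRaisingAtThree_of_cheb_iso`). (Cheb), as typed by koly3a, is LOCAL in
its conclusion: *a non-zero class `x ∈ SelQ n μ` (`n` good) has NON-ZERO LOCALISATION `loc_v x` at the place `v` above
some GOOD unipotent-admissible `q ∉ n`*. Its printed source (W. Zhang Lemma 7.3 ∕ Bertolini–Darmon Thm 3.2; at `p = 3`
koly MEMO-v8 §4, U3) is a Čebotarev argument producing a prime `q` and a FROBENIUS with prescribed image in
`Gal(K(E[3], x)/ℚ)`. This file supplies the passage from the Galois form to the local form, through the criterion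
`LocalFrob.oneCocycleClass_mem_torsionLocalKer_iff_apply_frob` (Gross Prop. 9.6 at a non-trivial Frobenius: for `x`
unramified at `v`, `loc_v x = 0 ⟺ [x, F] ∈ (F − 1)E[3]`) and the transport of the Frobenius to the prime `𝔓_{ι₀,𝔐}`
of the local picture (all primes above `v` are `Γ_K`-conjugate; `[x, γFγ⁻¹] ≡ γ[x, F]` modulo `(γFγ⁻¹ − 1)E[3]`):
(Cheb) ⟸ (Cheb-Gal) — *for every good level `n`, sign `μ` and non-zero `x ∈ SelQ n μ` there are a unipotent-admissible
`q ∉ n` with `Frob_q² ≠ 1` on `E[3]`, a prime `𝔔` of `\bar ℤ_K` above the place `v ∋ q` and an arithmetic Frobenius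
`F ∈ Γ_K` at `𝔔` with `[x, F] ≠ F m − m` for all `m ∈ E[3]`* (`[x, ·]` the tree's `h1Eval`, the value of the chosen
cocycle of `x`). HONEST FRAMING: theorems only; no definition, no named fact, no `sorry`; (Cheb-Gal) is NOT proved here
(it is the Čebotarev + sign-rule content, cf. the tree's `exists_kolyvaginPrime_gt` for Kolyvagin primes); nothing is
booked. PARTITION: O2@3 (B10) × A1 × crux 19574 × stub A — none (reduction of a typed input to its Galois form; T7).

References: [cite: WZhang2014, Lemma 7.3, Notations (xii)] [cite: BertoliniDarmon2005, Thm. 3.2] [cite: GrossLMS1991, §9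
Prop. 9.6] [cite: NeukirchANT1999, Ch. I §9 (9.1), (9.4)].
-/

noncomputable section

open scoped Pointwise
open WeierstrassCurve NumberField IsDedekindDomain Field
open Literature.NumberTheory.EllipticCurves Literature.NumberTheory.GaloisRepresentations Module

namespace Summit.BirchSwinnertonDyer.Rank1Residual.X11b.Three.Koly.Method2

universe u

namespace LocalFrob

/-- **The value of a cocycle at a conjugate Frobenius**: `φ(γ F γ⁻¹) = γ φ(F) − ((γFγ⁻¹) φ(γ) − φ(γ))`, so
`φ(γFγ⁻¹) ∈ (γFγ⁻¹ − 1)E[n] ⟺ φ(F) ∈ (F − 1)E[n]`. The useful half. [folklore] -/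
theorem exists_apply_frob_eq_of_conj {K : Type u} [Field K] (W : WeierstrassCurve K) {n : ℤ}
    (φ : contOneCocycles (discreteTopRep (absoluteGaloisGroup K) (geomTorsion W n))) (γ F : absoluteGaloisGroup K)
    {m : geomTorsion W n} (hm : φ.1 (γ * F * γ⁻¹) = (γ * F * γ⁻¹) • m - m) :
    ∃ m' : geomTorsion W n, φ.1 F = F • m' - m' := by
  have hF : F = γ⁻¹ * ((γ * F * γ⁻¹) * γ) := by group
  have h3 : φ.1 γ⁻¹ = -(γ⁻¹ • φ.1 γ) := by
    have h := φ.2 γ⁻¹ γ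
    rw [inv_mul_cancel, contOneCocycles.apply_one, discreteTopRep_ρ_apply] at h
    exact eq_neg_of_add_eq_zero_left h.symm
  refine ⟨γ⁻¹ • m + γ⁻¹ • φ.1 γ, ?_⟩
  conv_lhs => rw [hF]
  rw [φ.2, φ.2, discreteTopRep_ρ_apply, discreteTopRep_ρ_apply, hm, h3]
  simp only [smul_add, smul_sub, smul_smul]
  have e1 : γ⁻¹ * (γ * F * γ⁻¹) = F * γ⁻¹ := by group
  rw [e1]
  abel

end LocalFrob

section Cheb

variable (W : WeierstrassCurve ℚ) [W.IsElliptic] [W.IsGloballyMinimal] (K : Type) [Field K] [NumberField K]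
  (c : K ≃ₐ[ℚ] K)

/-- **(Cheb) of `selQ_rankLowering_on_of_localGlobal` from its GALOIS FORM.** Hypothesis (Cheb-Gal): for every good
level `n`, sign `μ` and non-zero `x ∈ SelQ n μ` there are a unipotent-admissible `q ∉ n` with `Frob_q² ≠ 1` on `E[3]`,
a place `v ∋ q`, a prime `𝔔 ∣ v` of `\bar ℤ_K` and an arithmetic Frobenius `F ∈ Γ_K` at `𝔔` with `[x, F] ≠ F m − m`
for all `m ∈ E(K̄)[3]` (`[x, ·] = h1Eval`, the chosen cocycle of `x`). Conclusion: (Cheb) VERBATIM — the localisation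
of `x` at `v` is non-zero. Proof: `x` is Kummer, hence unramified, at `v` (`q ∉ n`, good reduction, `v ∤ 3`); move
`F` to the prime `𝔓_{ι₀,𝔐}` of the local picture by `γ ∈ Γ_K` (`[x, γFγ⁻¹] ∉ (γFγ⁻¹ − 1)E[3]`,
`LocalFrob.exists_apply_frob_eq_of_conj`) and apply `LocalFrob.oneCocycleClass_mem_torsionLocalKer_iff_apply_frob`.
[cite: WZhang2014, Lemma 7.3] [cite: BertoliniDarmon2005, Thm. 3.2] [cite: GrossLMS1991, Prop. 9.6] -/
theorem localCheb_of_galoisCheb [Module (ZMod 3) (V3 W K)]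
    (hGal : ∀ (n : Finset {q // IsUAdmissiblePrime W K q}) (μ : Bool) (x : V3 W K), GoodLevel W K n →
      x ∈ SelQ W K c n μ → x ≠ 0 →
      ∃ q : {q // IsUAdmissiblePrime W K q}, q ∉ n ∧ FrobSqNeOneAt W 3 q.1 ∧
        ∃ (v : HeightOneSpectrum (𝓞 K)) (𝔔 : Ideal (absIntegers (𝓞 K) K)) (F : absoluteGaloisGroup K),
          ((q : ℕ) : 𝓞 K) ∈ v.asIdeal ∧ 𝔔 ∈ v.primesAbove ∧ IsArithFrobAt (𝓞 K) F 𝔔 ∧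
          ∀ m : geomTorsion (W.baseChange K) ((3 ^ 1 : ℕ) : ℤ),
            h1Eval (W.baseChange K) ((3 ^ 1 : ℕ) : ℤ) x F ≠ F • m - m) :
    ∀ (n : Finset {q // IsUAdmissiblePrime W K q}) (μ : Bool) (x : V3 W K), GoodLevel W K n →
      x ∈ SelQ W K c n μ → x ≠ 0 →
      ∃ q : {q // IsUAdmissiblePrime W K q}, q ∉ n ∧ FrobSqNeOneAt W 3 q.1 ∧ ∃ v : HeightOneSpectrum (𝓞 K),
        ((q : ℕ) : 𝓞 K) ∈ v.asIdeal ∧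
          (W.baseChange K).torsionLocMap (v.adicCompletion K) ((3 ^ 1 : ℕ) : ℤ) x ≠ 0 := by
  intro n μ x hn hx hx0
  obtain ⟨q, hqn, hqgood, v, 𝔔, F, hqv, h𝔔, hF, hval⟩ := hGal n μ x hn hx hx0
  refine ⟨q, hqn, hqgood, v, hqv, fun hloc ↦ ?_⟩
  -- the data at `v`
  obtain ⟨hgood, h3v⟩ := hasGoodReductionAt_of_uAdmissible W K q.2 v hqv
  obtain ⟨𝔐, h𝔐⟩ := v.localPrimesAbove_nonempty
  set ι₀ := closureEmb (K := K) (v.adicCompletion K) with hι₀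
  have h𝔓 := HeightOneSpectrum.primeBelow_mem_primesAbove (ι := ι₀) h𝔐
  haveI := h𝔓.1
  haveI := h𝔔.1
  have hI : (v.primeBelow ι₀ 𝔐).inertia (absoluteGaloisGroup K) ≤ torsionFixing (W.baseChange K) ((3 ^ 1 : ℕ) : ℤ) :=
    inertia_le_torsionFixing (W.baseChange K) (fun h' ↦ h' hgood) h3v ι₀ h𝔐
  -- `x` is Kummer, hence unramified, at `v`; its chosen cocycle vanishes on `I_𝔓`
  have hsel : x ∈ selmerLocalKer (W.baseChange K) (v.adicCompletion K) ((3 ^ 1 : ℕ) : ℤ) :=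
    mem_selmerLocalKer_of_mem_selQ W K c n q hqn v hqv μ hx
  set φ := reprCocycle (W.baseChange K) ((3 ^ 1 : ℕ) : ℤ) x with hφ
  have hclass : oneCocycleClass _ φ = x := oneCocycleClass_reprCocycle (W.baseChange K) _ x
  have hφI : ∀ τ ∈ (v.primeBelow ι₀ 𝔐).inertia (absoluteGaloisGroup K), φ.1 τ = 0 :=
    ((W.baseChange K).oneCocycleClass_mem_selmerLocalKer_iff hgood h3v h𝔓 φ).mp (by rw [hclass]; exact hsel)
  -- move `F` to the prime of the local picture
  obtain ⟨γ, hγ⟩ := HeightOneSpectrum.exists_smul_eq_of_mem_primesAbove_holds h𝔔 h𝔓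
  have hF' : IsArithFrobAt (𝓞 K) (γ * F * γ⁻¹) (v.primeBelow ι₀ 𝔐) := by rw [← hγ]; exact hF.conj γ
  -- `loc_v x = 0` gives `φ(γFγ⁻¹) ∈ (γFγ⁻¹ − 1)E[3]`, hence `φ(F) ∈ (F − 1)E[3]`
  have hmem : oneCocycleClass _ φ ∈ (W.baseChange K).torsionLocalKer (v.adicCompletion K) ((3 ^ 1 : ℕ) : ℤ) := by
    rw [hclass]; exact hloc
  obtain ⟨m, hm⟩ := (LocalFrob.oneCocycleClass_mem_torsionLocalKer_iff_apply_frob (W.baseChange K) (n := 3 ^ 1)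
    (by norm_num) h𝔐 hF' hI φ hφI).mp hmem
  obtain ⟨m', hm'⟩ := LocalFrob.exists_apply_frob_eq_of_conj (W.baseChange K) φ γ F hm
  exact hval m' hm'

end Cheb

end Summit.BirchSwinnertonDyer.Rank1Residual.X11b.Three.Koly.Method2

end
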